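import Literature.Topology.FourManifolds.TubeReadablePointwise
import HarnessLib

/-!
# Readable shell points from two pointwise estimates

Topic `Literature/Topology/FourManifolds`; bookkeeping for the first reading in the downward
sweep of the smoothing of PD homeomorphisms (Munkres, Ann. of Math. 72 (1960), §5;
Campbell–D'Onofrio–Vítek (2026), §3).  The stage interface `ShellPointReadable`
(`TubeReadablePointwise.lean`) asks, at a shell point `q = (x, y)`, for smoothness, a nonzero
value and radial transversality at the link level, fibre injectivity, the source-form Euler
defect bound and the flatten data.  All of these follow from TWO numbers at the point — a fibre
lower bound `m ‖w‖ ≤ ‖D N (q) (0, w)‖` and an Euler-defect bound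
`‖D N (q) (0, y) - N q‖ ≤ η ‖y‖` with `K₀ η < m` — together with the tangential bounds entering
the flatten inequality (`shellPointReadable_of_bounds`).  Over a zero-dimensional base (the
vertex stages, `E = ℝ⁰`) the tangential data are vacuous and the two numbers suffice
(`shellPointReadable_of_bounds_subsingleton`).  The regions of the sweep (original sectors,
crease bands, coface tube zones) then only have to produce `m` and `η` at each of their points.
Everything is proved; no definitions; no named facts.

## References

* J. R. Munkres, *Obstructions to the smoothing of piecewise-differentiable homeomorphisms*, Ann.
  of Math. (2) 72 (1960), 521–554, §5. [Munkres1960]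
* D. Campbell, L. D'Onofrio, T. Vítek, *Diffeomorphic approximation of piecewise affine
  homeomorphisms*, J. Geom. Anal. 36 (2026), §3. [CampbellDonofrioVitek2026]
-/

noncomputable section

open Set Function Metric Filter
open scoped Topology ContDiff RealInnerProductSpace

namespace Literature.Topology.FourManifolds

variable {E : Type*} [NormedAddCommGroup E] [NormedSpace ℝ E]
variable {F : Type*} [NormedAddCommGroup F] [InnerProductSpace ℝ F]
variable {T : E × F → E} {N : E × F → F} {r ρ K₀ C₁ m η X δ C D : ℝ}

/-- **Readable from two pointwise estimates.** At a shell point `q = (x, y)`,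
`r/4 ≤ ‖y‖ ≤ r`: if `N` is smooth at `q` (and `T` on the flatten shell), the fibre derivative is
bounded below, `m ‖w‖ ≤ ‖DN(q)(0,w)‖`, the Euler defect is `‖DN(q)(0,y) - N q‖ ≤ η ‖y‖` with
`K₀ η < m` (`K₀ ≥ 1`), the round radius satisfies `ρ ≤ m - η`, and the tangential data
`‖DN(q)(v,0)‖ ≤ X ‖v‖`, `‖DT(q)(v,0) - v‖ ≤ δ ‖v‖`, `‖DT(q)(0,w)‖ ≤ C ‖w‖`, `‖T q - x‖ ≤ D`
satisfy `δ + (C + C₁ D / r) X / m < 1`, then `q` is readable. [folklore] -/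
theorem shellPointReadable_of_bounds {q : E × F} (hr : 0 < r) (hq₁ : r / 4 ≤ ‖q.2‖)
    (hN : ContDiffAt ℝ ∞ N q) (hT : 5 * r / 8 ≤ ‖q.2‖ → ContDiffAt ℝ ∞ T q) (hm : 0 < m)
    (hfib : ∀ w : F, m * ‖w‖ ≤ ‖fderiv ℝ N q (0, w)‖) (hη0 : 0 ≤ η)
    (hdef : ‖fderiv ℝ N q (0, q.2) - N q‖ ≤ η * ‖q.2‖) (hK₀ : 1 ≤ K₀) (hK₀η : K₀ * η < m)
    (hρ : ρ ≤ m - η) (hX0 : 0 ≤ X) (hX : ∀ v : E, ‖fderiv ℝ N q (v, 0)‖ ≤ X * ‖v‖)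
    (hδ : ∀ v : E, ‖fderiv ℝ T q (v, 0) - v‖ ≤ δ * ‖v‖) (hC0 : 0 ≤ C)
    (hC : ∀ w : F, ‖fderiv ℝ T q (0, w)‖ ≤ C * ‖w‖) (hD0 : 0 ≤ D) (hD : ‖T q - q.1‖ ≤ D)
    (hflat : δ + (C + C₁ / r * D) * (X / m) < 1) :
    ShellPointReadable r ρ K₀ C₁ T N q := by
  obtain ⟨x, y⟩ := q
  simp only at hq₁ hdef hD ⊢
  have hy0 : 0 < ‖y‖ := lt_of_lt_of_le (by positivity) hq₁
  have hηm : η < m := by nlinarith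
  -- the value of `N` is bounded below on the fibre ray
  have hNge : (m - η) * ‖y‖ ≤ ‖N (x, y)‖ := by
    have h1 := hfib y
    have h2 : ‖fderiv ℝ N (x, y) (0, y)‖ ≤ ‖N (x, y)‖ + η * ‖y‖ := by
      calc ‖fderiv ℝ N (x, y) (0, y)‖
          = ‖N (x, y) + (fderiv ℝ N (x, y) (0, y) - N (x, y))‖ := by rw [add_sub_cancel]
        _ ≤ ‖N (x, y)‖ + ‖fderiv ℝ N (x, y) (0, y) - N (x, y)‖ := norm_add_le _ _
        _ ≤ ‖N (x, y)‖ + η * ‖y‖ := by gcongr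
    nlinarith
  refine
    { contDiffAt_N := hN
      contDiffAt_T := hT
      N_ne_zero := fun h => ?_
      fibre_injective := fun w hw => ?_
      source_defect := fun _ u hu => ?_
      transversal := fun _ v hv => ?_
      rho_le := fun h => ?_
      flatten := fun _ => ?_ }
  · -- nonzero at the link level
    intro h0
    rw [h0, norm_zero] at hNge
    nlinarith
  · -- fibre injectivity
    have h1 := hfib w
    rw [hw, norm_zero] at h1
    have : ‖w‖ ≤ 0 := by nlinarith
    exact norm_eq_zero.1 (le_antisymm this (norm_nonneg w))
  · -- source-form Euler defect: `m ‖u‖ ≤ η ‖y‖`, so `K₀ ‖u‖ ≤ (K₀ η / m) ‖y‖ < ‖y‖`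
    have h1 : m * ‖u‖ ≤ η * ‖y‖ := by
      calc m * ‖u‖ ≤ ‖fderiv ℝ N (x, y) (0, u)‖ := hfib u
        _ = ‖fderiv ℝ N (x, y) (0, y) - N (x, y)‖ := by rw [hu]
        _ ≤ η * ‖y‖ := hdef
    have h2 : K₀ * ‖u‖ * m ≤ K₀ * η * ‖y‖ := by
      have := mul_le_mul_of_nonneg_left h1 (by linarith : (0 : ℝ) ≤ K₀)
      nlinarith
    have h3 : K₀ * η * ‖y‖ < m * ‖y‖ := mul_lt_mul_of_pos_right hK₀η hy0
    nlinarith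
  · -- radial transversality: `m ‖v - y‖ ≤ η ‖y‖`
    have h1 : m * ‖v - y‖ ≤ η * ‖y‖ := by
      have e : fderiv ℝ N (x, y) (0, v - y) = N (x, y) - fderiv ℝ N (x, y) (0, y) := by
        have : ((0 : E), v - y) = ((0 : E), v) - ((0 : E), y) := by ext <;> simp
        rw [this, map_sub, hv]
      calc m * ‖v - y‖ ≤ ‖fderiv ℝ N (x, y) (0, v - y)‖ := hfib _
        _ = ‖fderiv ℝ N (x, y) (0, y) - N (x, y)‖ := by rw [e, norm_sub_rev]
        _ ≤ η * ‖y‖ := hdef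
    have h2 : ⟪v, y⟫ = ‖y‖ ^ 2 + ⟪v - y, y⟫ := by
      rw [inner_sub_left, real_inner_self_eq_norm_sq]; ring
    have h3 : |⟪v - y, y⟫| ≤ ‖v - y‖ * ‖y‖ := abs_real_inner_le_norm _ _
    have h4 : ‖v - y‖ * ‖y‖ * m ≤ η * ‖y‖ * ‖y‖ := by nlinarith [norm_nonneg (v - y)]
    have h5 : η * ‖y‖ * ‖y‖ < m * ‖y‖ * ‖y‖ :=
      mul_lt_mul_of_pos_right (mul_lt_mul_of_pos_right hηm hy0) hy0
    rw [h2]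
    nlinarith [abs_le.1 h3, sq_nonneg ‖y‖, norm_nonneg (v - y)]
  · -- round radius
    rw [h] at hNge
    exact le_trans (mul_le_mul_of_nonneg_right hρ (by positivity)) hNge
  · -- flatten data
    refine ⟨X / m, δ, C, D, hC0, div_nonneg hX0 hm.le, hD0, fun v w hvw => ?_, hδ, hC, hD, hflat⟩
    have e : fderiv ℝ N (x, y) (0, w) = -fderiv ℝ N (x, y) (v, 0) := by
      have : ((v : E), w) = ((v : E), (0 : F)) + ((0 : E), w) := by ext <;> simp
      rw [this, map_add] at hvw
      exact eq_neg_of_add_eq_zero_right hvw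
    have h1 : m * ‖w‖ ≤ X * ‖v‖ := by
      calc m * ‖w‖ ≤ ‖fderiv ℝ N (x, y) (0, w)‖ := hfib w
        _ = ‖fderiv ℝ N (x, y) (v, 0)‖ := by rw [e, norm_neg]
        _ ≤ X * ‖v‖ := hX v
    rw [div_mul_eq_mul_div, le_div_iff₀ hm]
    linarith

/-- **Readable from two pointwise estimates over a zero-dimensional base** (the vertex stages):
with `E` a point, the tangential data are vacuous. [folklore] -/
theorem shellPointReadable_of_bounds_subsingleton [Subsingleton E] {q : E × F} (hr : 0 < r)
    (hq₁ : r / 4 ≤ ‖q.2‖) (hN : ContDiffAt ℝ ∞ N q) (hm : 0 < m)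
    (hfib : ∀ w : F, m * ‖w‖ ≤ ‖fderiv ℝ N q (0, w)‖) (hη0 : 0 ≤ η)
    (hdef : ‖fderiv ℝ N q (0, q.2) - N q‖ ≤ η * ‖q.2‖) (hK₀ : 1 ≤ K₀) (hK₀η : K₀ * η < m)
    (hρ : ρ ≤ m - η) : ShellPointReadable r ρ K₀ C₁ T N q := by
  have hE : ∀ v : E, v = 0 := fun v => Subsingleton.elim _ _
  refine shellPointReadable_of_bounds (X := 0) (δ := 0) (C := 0) (D := 0) hr hq₁ hN
    (fun _ => contDiff_of_subsingleton.contDiffAt) hm hfib hη0 hdef hK₀ hK₀η hρ le_rfl ?_ ?_ le_rfl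
    ?_ le_rfl ?_ (by simp)
  · intro v
    rw [hE v, show ((0 : E), (0 : F)) = (0 : E × F) from rfl, map_zero, norm_zero, norm_zero,
      mul_zero]
  · intro v
    rw [hE (fderiv ℝ T q (v, 0) - v), norm_zero, zero_mul]
  · intro w
    rw [hE (fderiv ℝ T q (0, w)), norm_zero, zero_mul]
  · rw [hE (T q - q.1), norm_zero]

/-- **Readability is a first-order property at the point**: if `(T, N)` and `(T', N')` agree
near `q` and `q` is readable for `(T', N')`, then it is readable for `(T, N)` (in the sweep the
actual map agrees near each shell point with a smooth model or a record). [folklore] -/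
theorem ShellPointReadable.congr {T' : E × F → E} {N' : E × F → F} {q : E × F}
    (h : ShellPointReadable r ρ K₀ C₁ T' N' q) (hT : T =ᶠ[𝓝 q] T') (hN : N =ᶠ[𝓝 q] N') :
    ShellPointReadable r ρ K₀ C₁ T N q := by
  have hNq : N q = N' q := hN.self_of_nhds
  have hTq : T q = T' q := hT.self_of_nhds
  have hfN : fderiv ℝ N q = fderiv ℝ N' q := hN.fderiv_eq
  have hfT : fderiv ℝ T q = fderiv ℝ T' q := hT.fderiv_eq
  exact
    { contDiffAt_N := h.contDiffAt_N.congr_of_eventuallyEq hN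
      contDiffAt_T := fun h5 => (h.contDiffAt_T h5).congr_of_eventuallyEq hT
      N_ne_zero := fun h4 => by rw [hNq]; exact h.N_ne_zero h4
      fibre_injective := fun w hw => h.fibre_injective w (by rwa [hfN] at hw)
      source_defect := fun h2 u hu => h.source_defect h2 u (by rwa [hfN, hNq] at hu)
      transversal := fun h4 v hv => h.transversal h4 v (by rwa [hfN, hNq] at hv)
      rho_le := fun h4 => by rw [hNq]; exact h.rho_le h4
      flatten := fun h5 => by
        obtain ⟨K, δ', C', D', hC', hK, hD', h1, h2, h3, h4, h5'⟩ := h.flatten h5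
        refine ⟨K, δ', C', D', hC', hK, hD', fun v w hvw => h1 v w (by rwa [hfN] at hvw),
          fun v => by rw [hfT]; exact h2 v, fun w => by rw [hfT]; exact h3 w,
          by rw [hTq]; exact h4, h5'⟩ }

end Literature.Topology.FourManifolds
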